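import Literature.AlgebraicGeometry.AbelianSchemes.AbelianSchemeDualTransportOfBaseChangeFunctorial
import Literature.AlgebraicGeometry.RelativeSpec.FiniteGroupQuotient
import HarnessLib

/-!
# A finite-group action on an abelian scheme covering an action on the base LIFTS TO THE DUAL, with the Poincaré clause
# ([MilneAV2008] I §8 — the dual pair is unique up to unique isomorphism; [MFK94] Cor. 6.8 `(X ×_S T)^ = X̂ ×_S T`)

Topic `AlgebraicGeometry/AbelianSchemes`; namespace `Literature.AlgebraicGeometry.AbelianSchemes.AbelianSchemeOver.DualPair`.
THEOREMS ONLY (no definition, no named fact, no instance, no notation, no `sorry`; net Literature debt 0).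

SETTING.  `ρ : ActionOver p G` an action of a group `G` on a scheme `S` over `p : S → Q`; `A → S` an abelian scheme with a dual
pair `D = (Â, 𝒫)` (★ `DualPair`); `ρA : ActionOver π G` an action of `G` on the total space of `A` (over some invariant `π`) which
COVERS `ρ` by isomorphisms of group schemes: `hA : ∀ g, A.IsBaseChangeVia A (ρ g) (ρA g)` (each `ρA(g)` is a cartesian square of
group schemes over `ρ(g)`).  Then `G` acts on the DUAL `Â`, covering `ρ`, by the DUAL TRANSPORTS `ρ̂(g) := Ĝ_{ρA(g)}` (★ FILE A
`AbelianSchemeDualTransportOfBaseChange.hatTransportOfBaseChange D D (hA g)` — «`(X ×_S T)^ = X̂ ×_S T`» read along the square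
`(ρ(g), ρA(g))`): FUNCTORIALITY of the dual transport (★ `hatTransportOfBaseChange_refl` / `_trans`, [MilneAV2008] I §8 «unique up
to a unique isomorphism») makes `g ↦ ρ̂(g)` a group homomorphism `G →* Aut Â`; each `ρ̂(g)` lies over `ρ(g)`, carries the POINCARÉ
CLAUSE `(ρA(g) ×_{ρ(g)} ρ̂(g))^* 𝒫 ≅ 𝒫` (★ `nonempty_pullback_map_hatTransportOfBaseChange_iso`) and — over a locally Noetherian `S`
and for a HAT-NORMALISED `𝒫` (`𝒫|_{A × {ε_Â}} ≅ 𝒪`, ★ `DualPair.normalize`) — is a cartesian square OF GROUP SCHEMES (★ A2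
`hat_isBaseChangeVia_hatTransportOfBaseChange_of_isLocallyNoetherian_base`).  These are EXACTLY the inputs `ρÂ` / `hÂ` / `hP` of
the base-quotient descent of the dual pair (★ `PoincareBaseQuotientDescent`, ★ `DualPairBaseQuotientDescent(OfNoetherian)`).

* §1 `hatTransportOfBaseChange_actionOver_one`, `hatTransportOfBaseChange_actionOver_mul` — `ρ̂(1) = 𝟙`,
  `ρ̂(g h) = ρ̂(h) ≫ ρ̂(g)` (the `Aut`-convention `(x * y).hom = y.hom ≫ x.hom`).
* §2 **`exists_actionOver_hat_of_isBaseChangeVia`** — THE HEAD: `∃ ρ̂ : ActionOver (Â → S → Q) G` with `ρ̂(g) = Ĝ_{ρA(g)}`,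
  lying over `ρ(g)`, cartesian as group schemes (`hÂ`), and the Poincaré clause for every `g`.

Cell `hodgecm-mathlib` (D-0151), FLOOR 0 programme P1, sub-line `Cruxes/HDel/Lines/F3DualAbelianScheme`, stub (M) `stub_F3M`,
B-typ04 (g15) second-layer letter (Md1) `stub_F3Md1` (`typers/B-typ04/F3/STUBMENU-F3M-letters.v0` d823bfca §5): §2 IS that letter
(its unused carrier binders `hq`/`hfree`/`hAB` dropped — they are not needed for the action on the dual).  Count-neutral; HC_CM is
proved only modulo the 7 printed citations until rung 0 closes; nothing here is about HC.

Mathlib searched (pin): `CategoryTheory.Aut` (`Aut.Aut_mul_def`, group structure `x * y = y ≪≫ x`), `MonoidHom` anonymous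
constructor, `map_one`, `map_mul` (used); Mathlib has no abelian schemes and no dual abelian scheme.

## References
* J. S. Milne, *Abelian Varieties* (v2.00, 2008), I §8 pp. 36–37 (the dual pair is determined up to a unique isomorphism).
  [MilneAV2008]
* D. Mumford, J. Fogarty, F. Kirwan, *Geometric Invariant Theory*, 3rd ed. (1994), Ch. 6 §1 Cor. 6.4 (p. 117), Cor. 6.8
  (p. 118); Ch. 7 §2 Def. 7.2/7.3 (p. 129), remark after Def. 7.5 (p. 130); Ch. 7 §3 remark after Thm. 7.9 (p. 139).
  [MumfordFogartyKirwan1994]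
-/

noncomputable section

universe u

open CategoryTheory CategoryTheory.Limits AlgebraicGeometry

namespace Literature.AlgebraicGeometry.AbelianSchemes.AbelianSchemeOver.DualPair

open Literature.AlgebraicGeometry.RelativeSpec

variable {S Q : Scheme.{u}} {p : S ⟶ Q} {G : Type*} [Group G] (ρ : ActionOver p G)
  {A : AbelianSchemeOver S} (D : A.DualPair) {Y : Scheme.{u}} {π : A.X.left ⟶ Y} (ρA : ActionOver π G)
  (hA : ∀ g : G, A.IsBaseChangeVia A (ρ.aut g).hom (ρA.aut g).hom)

/-! ### §1 Functoriality of `g ↦ Ĝ_{ρA(g)}` -/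

/-- **`ρ̂(1) = 𝟙`**: the dual transport along the square `(ρ(1), ρA(1)) = (𝟙, 𝟙)` is the identity (★ `hatTransportOfBaseChange_congr`
to the identity square, ★ `hatTransportOfBaseChange_refl`). [cite: MilneAV2008, I §8 pp. 36–37]
[cite: MumfordFogartyKirwan1994, Ch. 7 §2 Definition 7.2 (p. 129)] -/
theorem hatTransportOfBaseChange_actionOver_one :
    hatTransportOfBaseChange D D (hA 1) = 𝟙 D.hat.X.left := by
  have e1 : (ρ.aut 1).hom = 𝟙 S := by rw [map_one]; rfl
  have e2 : (ρA.aut 1).hom = 𝟙 A.X.left := by rw [map_one]; rfl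
  rw [hatTransportOfBaseChange_congr D D (hA 1) e1 e2 (IsBaseChangeVia.refl A)]
  exact hatTransportOfBaseChange_refl D

/-- **`ρ̂(g h) = ρ̂(h) ≫ ρ̂(g)`**: the dual transport along the square for `g * h` — which is the COMPOSITE square `(ρ(h) ≫ ρ(g),
ρA(h) ≫ ρA(g))` in the `Aut`-convention `(x * y).hom = y.hom ≫ x.hom` — is the composite of the dual transports (★
`hatTransportOfBaseChange_congr` + ★ `hatTransportOfBaseChange_trans`; [MilneAV2008] I §8 uniqueness).
[cite: MilneAV2008, I §8 pp. 36–37] [cite: MumfordFogartyKirwan1994, Ch. 6 §1 Cor. 6.8 (p. 118)] -/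
theorem hatTransportOfBaseChange_actionOver_mul (g h : G) :
    hatTransportOfBaseChange D D (hA (g * h)) =
      hatTransportOfBaseChange D D (hA h) ≫ hatTransportOfBaseChange D D (hA g) := by
  have e1 : (ρ.aut (g * h)).hom = (ρ.aut h).hom ≫ (ρ.aut g).hom := by rw [map_mul]; rfl
  have e2 : (ρA.aut (g * h)).hom = (ρA.aut h).hom ≫ (ρA.aut g).hom := by rw [map_mul]; rfl
  rw [hatTransportOfBaseChange_congr D D (hA (g * h)) e1 e2 ((hA h).trans (hA g))]
  exact hatTransportOfBaseChange_trans D D D (hA g) (hA h)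

/-- `ρ̂(g⁻¹) ≫ ρ̂(g) = 𝟙`. [cite: MilneAV2008, I §8 pp. 36–37] -/
theorem hatTransportOfBaseChange_actionOver_inv_comp (g : G) :
    hatTransportOfBaseChange D D (hA g⁻¹) ≫ hatTransportOfBaseChange D D (hA g) = 𝟙 D.hat.X.left := by
  rw [← hatTransportOfBaseChange_actionOver_mul ρ D ρA hA g g⁻¹, mul_inv_cancel,
    hatTransportOfBaseChange_actionOver_one ρ D ρA hA]

/-- `ρ̂(g) ≫ ρ̂(g⁻¹) = 𝟙`. [cite: MilneAV2008, I §8 pp. 36–37] -/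
theorem hatTransportOfBaseChange_actionOver_comp_inv (g : G) :
    hatTransportOfBaseChange D D (hA g) ≫ hatTransportOfBaseChange D D (hA g⁻¹) = 𝟙 D.hat.X.left := by
  rw [← hatTransportOfBaseChange_actionOver_mul ρ D ρA hA g⁻¹ g, inv_mul_cancel,
    hatTransportOfBaseChange_actionOver_one ρ D ρA hA]

/-! ### §2 The action on the dual, covering `ρ`, with the group-scheme clause and the Poincaré clause -/

/-- **A GROUP ACTION ON AN ABELIAN SCHEME COVERING AN ACTION ON THE BASE LIFTS TO THE DUAL** ([MilneAV2008] I §8: the dual pair is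
unique up to a unique isomorphism; [MumfordFogartyKirwan1994] Cor. 6.8 / remark after Def. 7.5: `(X ×_S T)^ = X̂ ×_S T`).  For
`ρ` an action of `G` on `S` over `p : S → Q`, `A/S` an abelian scheme over the locally Noetherian `S` with a HAT-NORMALISED dual pair
`D = (Â, 𝒫)` (`𝒫|_{A × {ε_Â}} ≅ 𝒪`; every dual pair can be so normalised, ★ `DualPair.normalize`), and `ρA` an action of `G` on the
total space of `A` covering `ρ` by isomorphisms of group schemes (`hA`): there is an action `ρ̂` of `G` on the total space of `Â`
over `Â → S → Q`, namely `ρ̂(g) = Ĝ_{ρA(g)}` (the dual transport along the square `(ρ(g), ρA(g))`), such that every `ρ̂(g)` LIES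
OVER `ρ(g)`, is a CARTESIAN SQUARE OF GROUP SCHEMES `Â ≅ Â ×_{S, ρ(g)} S` (`hÂ`), and carries the POINCARÉ CLAUSE
`(ρA(g) ×_{ρ(g)} ρ̂(g))^* 𝒫 ≅ 𝒫`.  These are the inputs `ρÂ`/`hÂ`/`hP` of ★ `PoincareBaseQuotientDescent` / ★
`DualPairBaseQuotientDescent` (and of their `…OfNoetherian` editions) when `p` is a free finite quotient of the base; = B-typ04 (g15)'s
(M) letter (Md1). [cite: MilneAV2008, I §8 pp. 36–37] [cite: MumfordFogartyKirwan1994, Ch. 6 §1 Cor. 6.4 (p. 117) and Cor. 6.8 (p. 118)]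
[cite: MumfordFogartyKirwan1994, Ch. 7 §2 Definition 7.3 (p. 129) and Ch. 7 §3 remark after Thm. 7.9 (p. 139)] -/
theorem exists_actionOver_hat_of_isBaseChangeVia [IsLocallyNoetherian S]
    (hunit : Nonempty ((Scheme.Modules.pullback (unitHatSlice D)).obj D.P ≅ SheafOfModules.unit _)) :
    ∃ (ρh : ActionOver (D.hat.X.hom ≫ p) G) (_ : ∀ g : G, (ρh.aut g).hom = hatTransportOfBaseChange D D (hA g))
      (_ : ∀ g : G, (ρh.aut g).hom ≫ D.hat.X.hom = D.hat.X.hom ≫ (ρ.aut g).hom)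
      (hAh : ∀ g : G, D.hat.IsBaseChangeVia D.hat (ρ.aut g).hom (ρh.aut g).hom),
      ∀ g : G, Nonempty ((Scheme.Modules.pullback
        (pullback.map A.X.hom D.hat.X.hom A.X.hom D.hat.X.hom (ρA.aut g).hom (ρh.aut g).hom (ρ.aut g).hom
          (hA g).fst.symm (hAh g).fst.symm)).obj D.P ≅ D.P) := by
  -- the dual transports as isomorphisms
  let e : G → (D.hat.X.left ≅ D.hat.X.left) := fun g =>
    { hom := hatTransportOfBaseChange D D (hA g)
      inv := hatTransportOfBaseChange D D (hA g⁻¹)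
      hom_inv_id := hatTransportOfBaseChange_actionOver_comp_inv ρ D ρA hA g
      inv_hom_id := hatTransportOfBaseChange_actionOver_inv_comp ρ D ρA hA g }
  -- functoriality makes `g ↦ e g` a homomorphism to `Aut Â` (`(x * y).hom = y.hom ≫ x.hom`)
  let aut : G →* Aut D.hat.X.left :=
    { toFun := e
      map_one' := Iso.ext (hatTransportOfBaseChange_actionOver_one ρ D ρA hA)
      map_mul' := fun g h => Iso.ext (hatTransportOfBaseChange_actionOver_mul ρ D ρA hA g h) }
  have haut : ∀ g : G, (aut g).hom = hatTransportOfBaseChange D D (hA g) := fun _ => rfl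
  -- `ρ̂(g)` lies over `ρ(g)`
  have hover : ∀ g : G, (aut g).hom ≫ D.hat.X.hom = D.hat.X.hom ≫ (ρ.aut g).hom := fun g =>
    hatTransportOfBaseChange_comp_hom D D (hA g)
  let ρh : ActionOver (D.hat.X.hom ≫ p) G := ⟨aut, fun g => by
    rw [← Category.assoc, hover g, Category.assoc, ρ.aut_comp g]⟩
  -- the group-scheme clause (hat-normalised `𝒫`, `S` locally Noetherian) and the Poincaré clause
  have hAh : ∀ g : G, D.hat.IsBaseChangeVia D.hat (ρ.aut g).hom (ρh.aut g).hom := fun g =>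
    hat_isBaseChangeVia_hatTransportOfBaseChange_of_isLocallyNoetherian_base D D (hA g) hunit hunit
  refine ⟨ρh, haut, hover, hAh, fun g => ?_⟩
  exact nonempty_pullback_map_hatTransportOfBaseChange_iso D D (hA g) (hA g).fst.symm (hAh g).fst.symm

end Literature.AlgebraicGeometry.AbelianSchemes.AbelianSchemeOver.DualPair

end
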